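import Literature.IUT.LogVolume.SubThetaFieldRamificationWildLemmas
import Literature.NumberTheory.EllipticCurves.TateCurve.InertiaTorsionOfTateParameterPower
import HarnessLib

/-!
# The ramification of a field pinned by the v3 Θ-datum at a WILD bad place `v ∣ p ∈ {3, 5}`, SPLIT case
# (Tate parameter a `p`-th power in `F_{tpd,v}`): `e(w | v) ∣ (p − 1)·p′`, and `∣ p − 1` when `p′ ∣ ord_v j(λ)`

J.-P. Serre, *Propriétés galoisiennes des points d'ordre fini des courbes elliptiques*, Invent. Math. **15** (1972),
§1.11–§1.12 («courbes de Tate»: at a multiplicative `v ∣ p` the inertia group acts on `E[p]` through `(χ *; 0 1)`, the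
`*` being the Kummer cocycle of the Tate parameter `q`; when `q ∈ (K_v^×)^p` it VANISHES and the image of inertia has
order dividing `p − 1`); J. H. Silverman, *Advanced Topics*, Thm. V.3.1 (c),(d), Lemma V.5.2 (c), Thm. V.5.3
(`K_v(E_q[p]) = K_v(ζ_p, q^{1/p})`, twist by the unramified `χ`); S. Mochizuki, *Inter-universal Teichmüller theory IV*,
Thm. 1.10 Step (iii) (R2)–(R4) p. 25–26 (locus of use only: the per-place ramification budget of the layer `F/F_tpd`).

Sequel of `SubThetaFieldRamificationWild` (abc-iut-W-neg-1 gen 2: `e(w | v) ∣ p(p − 1)p′` via Serre's line and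
unipotence). THIS FILE removes the factor `p` under the SPLIT hypothesis «the Tate parameter `q₀ ∈ F_{tpd,v}` of `E_λ`
at `v` (the unique `q₀` with `|q₀|_v < 1`, `j(E_{q₀}) = j(λ)`) is a `p`-th power in `F_{tpd,v}`»:
* `Cor22.ramificationIdx_subThetaField_dvd_split_of_forall_inertia` — abstract form: inertia elements fixing `μ_p`
  act trivially on `E′[p]` (every multiplicative twist `E′ = E_λ^{(d)}` at `v`) and `ρ̄_{E_λ,p′}(σ)^k = 1` on
  `I_𝔓 ∩ Γ_{F_tpd(√d)}` ⇒ **`e(w | v) ∣ (p − 1)·k`**;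
* `Cor22.galoisRepTorsion_quadraticTwist_eq_one_of_split` — the SPLIT hypothesis supplies the first input (this
  seat's `WeierstrassCurve.galoisRepTorsion_eq_one_of_mem_inertia_of_pow_eq_tateParameter`, Silverman V.3.1/V.5.3);
* **`Cor22.ramificationIdx_subThetaField_dvd_split`** — SPLIT ⇒ `e(w | v) ∣ (p − 1)·p′` (`k = p′`, unipotence of
  tame inertia, abc-iut-L5-t12); **`Cor22.ramificationIdx_subThetaField_dvd_split_of_dvd_ord`** — SPLIT and
  `p′ ∣ ord_v j(λ)` ⇒ `e(w | v) ∣ p − 1` (`k = 1`, Tate criterion `galoisRepTorsion_eq_one_of_mem_inertia_of_dvd_ord`).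

PROOF: the inertia chain of `SubThetaFieldRamificationWild` with Serre's line and the unipotent index-`p` step REPLACED
by `Z = ker χ̄_p` (`χ̄_p` the mod-`p` cyclotomic character, Mathlib's `IsPrimitiveRoot.autToPow`):
`[I : I ∩ Z] = #χ̄_p(I) ∣ #(ℤ/p)^× = p − 1`, `I ∩ Z ≤ ker ρ̄_{E′,p}` (SPLIT input), then as before every element of
`I ∩ ker ρ̄_{E′,p}` fixes `μ_p` (Weil pairing), `√p*`, every `√a` (`a ∈ F_tpd^×`, `ord_v p = 1`), lies in
`Γ_{F_tpd(√d)} ∩ ker ρ̄_{E_λ,p}`, and `ρ̄_{E_λ,p′}` contributes `k`: `e(w | v) ∣ [I : I ∩ gens-fixer] ∣ (p − 1)·k`.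
Numerically (abc-iut W-num-2's SPLIT pole pairs, `p ∣ t`, `u^{p−1} ≡ 1 (mod p²)`): `e(F_w/ℚ_p) ∣ (p−1)·r`,
`r = p′/gcd(p′, t)` — the UPPER half of the exact SPLIT type `e(K_u/ℚ_p) = (p − 1)·r·l` closing the two-candidate
residual of GAP G-Wnum2-1 (i). Proof-only (no definition, no named fact); classical; TAKES NO SIDE on [IUTchIII] Cor. 3.12.
-/

noncomputable section

open scoped Classical

namespace Literature.IUT.LogVolume

namespace Cor22

open NumberField IsDedekindDomain Literature.NumberTheory.DiophantineGeometry.GenEll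
open Literature.NumberTheory.EllipticCurves Literature.NumberTheory.GaloisRepresentations
open Literature.NumberTheory.NumberFields WeierstrassCurve IntermediateField Field

/-! ## §0. Dictionary lemmas on `ord` (as in `SubThetaFieldRamificationWild`) -/

section Ord

variable {F₀ : Type*} [Field F₀] [NumberField F₀]

/-- `val_v(x) = exp(−ord_v x)` for `x ≠ 0`. [folklore] -/
private theorem valuation_eq_exp_neg_ord (v : HeightOneSpectrum (𝓞 F₀)) {x : F₀} (hx : x ≠ 0) :
    v.valuation F₀ x = WithZero.exp (-ord F₀ v x) := by
  have hne : v.valuation F₀ x ≠ 0 := by rwa [ne_eq, map_eq_zero]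
  rw [ord, neg_neg, WithZero.exp_log hne]

/-- `ord_v(−x) = ord_v(x)`. [folklore] -/
private theorem ord_neg' (v : HeightOneSpectrum (𝓞 F₀)) (x : F₀) : ord F₀ v (-x) = ord F₀ v x := by
  unfold ord; rw [Valuation.map_neg]

omit [NumberField F₀] in
/-- Two coprime natural numbers do not both lie in a proper ideal. [folklore] -/
private theorem natCast_not_mem_of_coprime (v : HeightOneSpectrum (𝓞 F₀)) {m p : ℕ} (hmp : Nat.Coprime m p)
    (hpv : ((p : ℕ) : 𝓞 F₀) ∈ v.asIdeal) : ((m : ℕ) : 𝓞 F₀) ∉ v.asIdeal := by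
  intro hmv
  have hbez := Int.gcd_eq_gcd_ab (m : ℤ) (p : ℤ)
  rw [Int.gcd_natCast_natCast, hmp, Nat.cast_one] at hbez
  have h1 : ((1 : ℤ) : 𝓞 F₀) ∈ v.asIdeal := by
    rw [hbez]
    push_cast
    exact v.asIdeal.add_mem (v.asIdeal.mul_mem_right _ hmv) (v.asIdeal.mul_mem_right _ hpv)
  rw [Int.cast_one] at h1
  exact v.isPrime.ne_top ((Ideal.eq_top_iff_one _).mpr h1)

end Ord

variable {P : NFPoint} (F : Type) [Field F] [NumberField F] [Algebra P.F F]

/-- **The split-inertia argument, abstract form: `e(w | v) ∣ (p − 1)·k`.** `P ∈ U`, `F` Galois over `F_tpd` with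
`IsSubThetaField P F`, `w | v` with `v ∈ badPlaces P`, `v ∣ p`, `{p, q} = {3, 5}`, `v` UNRAMIFIED over `p` (`ord_v(p) = 1`),
and `k ∣ q`. Suppose that for every prime `𝔓 | v` of `\bar ℤ_{F_tpd}`, every `d ≠ 0` with `E′ = E_λ^{(d)}` multiplicative at
`v`, and every `σ ∈ I_𝔓`: (Hp) if `σ` fixes every `p`-th root of unity then `ρ̄_{E′,p}(σ) = 1` (the SPLIT input: no wild
inertia on `E′[p]`), and (H) if `σ` fixes `√d` then `ρ̄_{E_λ,q}(σ)^k = 1`. THEN `e(w | v) ∣ (p − 1)·k`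
(`[I : I ∩ ker χ̄_p] ∣ p − 1`, `I ∩ ker χ̄_p ≤ ker ρ̄_{E′,p}` by (Hp), then the chain of the wild file). [cite: Serre1972, §1.11–§1.12] [cite: SilvermanATAEC1994, Thm. V.3.1 (c),(d), Thm. V.5.3 (PDF pp. 395–410)]
[cite: Mochizuki2012, IUTchIV Thm 1.10 proof Step (iii) (R2)–(R4) p.25–26] -/
theorem ramificationIdx_subThetaField_dvd_split_of_forall_inertia (hU : P.InU) (hF : IsSubThetaField P F)
    [IsGalois P.F F] (w : HeightOneSpectrum (𝓞 F)) (hbad : finBelow P.F F w ∈ badPlaces P)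
    {p q : ℕ} (hpq : (p = 3 ∧ q = 5) ∨ (p = 5 ∧ q = 3))
    (hpv : ((p : ℕ) : 𝓞 P.F) ∈ (finBelow P.F F w).asIdeal)
    (hp1 : ord P.F (finBelow P.F F w) (p : P.F) = 1) {k : ℕ} (hk : k ∣ q)
    (Hp : ∀ (𝔓 : Ideal (absIntegers (𝓞 P.F) P.F)), 𝔓 ∈ (finBelow P.F F w).primesAbove → ∀ (d : P.F), d ≠ 0 →
      (P.legendreCurve.quadraticTwist d).HasMultiplicativeReductionAt (finBelow P.F F w) →
      ∀ σ ∈ 𝔓.inertia (absoluteGaloisGroup P.F), (∀ ζ : AlgebraicClosure P.F, ζ ^ p = 1 → σ • ζ = ζ) →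
        (P.legendreCurve.quadraticTwist d).galoisRepTorsion ((p : ℕ) : ℤ) σ = 1)
    (H : ∀ (𝔓 : Ideal (absIntegers (𝓞 P.F) P.F)), 𝔓 ∈ (finBelow P.F F w).primesAbove → ∀ (d : P.F), d ≠ 0 →
      (P.legendreCurve.quadraticTwist d).HasMultiplicativeReductionAt (finBelow P.F F w) →
      ∀ σ ∈ 𝔓.inertia (absoluteGaloisGroup P.F), σ • geomSqrt d = geomSqrt d →
        P.legendreCurve.galoisRepTorsion ((q : ℕ) : ℤ) σ ^ k = 1) :
    w.asIdeal.ramificationIdx (𝓞 P.F) ∣ (p - 1) * k := by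
  haveI : P.legendreCurve.IsElliptic := P.legendreCurve_isElliptic_iff.2 hU
  have hp : p.Prime := by rcases hpq with ⟨rfl, -⟩ | ⟨rfl, -⟩ <;> norm_num
  have hq : q.Prime := by rcases hpq with ⟨-, rfl⟩ | ⟨-, rfl⟩ <;> norm_num
  haveI : Fact p.Prime := ⟨hp⟩
  haveI : Fact q.Prime := ⟨hq⟩
  haveI : Fact (Nat.Prime 3) := ⟨Nat.prime_three⟩
  haveI : Fact (Nat.Prime 5) := ⟨Nat.prime_five⟩
  haveI : NeZero (p : P.F) := ⟨Nat.cast_ne_zero.mpr hp.ne_zero⟩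
  set v := finBelow P.F F w with hvdef
  haveI := v.isPrime
  have h2 : ((2 : ℕ) : 𝓞 P.F) ∉ v.asIdeal :=
    natCast_not_mem_of_coprime v (by rcases hpq with ⟨rfl, -⟩ | ⟨rfl, -⟩ <;> norm_num) hpv
  have h2' : (2 : 𝓞 P.F) ∉ v.asIdeal := by exact_mod_cast h2
  haveI : FiniteDimensional P.F F := Module.Finite.of_restrictScalars_finite ℚ P.F F
  set Ω := AlgebraicClosure P.F
  let φ : F →ₐ[P.F] Ω := IsAlgClosed.lift
  set S : Set F := subThetaFieldGenerators P F with hSdef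
  set L : IntermediateField P.F Ω := IntermediateField.adjoin P.F (φ '' S) with hLdef
  have hL : φ.fieldRange = L := by
    rw [AlgHom.fieldRange_eq_map, ← hF.adjoin_eq_top, IntermediateField.adjoin_map]
  let e : F ≃ₐ[P.F] L :=
    (((IntermediateField.topEquiv (F := P.F) (E := F)).symm.trans (IntermediateField.equivMap ⊤ φ)).trans
      (IntermediateField.equivOfEq (AlgHom.fieldRange_eq_map φ).symm)).trans
      (IntermediateField.equivOfEq hL)
  haveI : FiniteDimensional P.F L := LinearEquiv.finiteDimensional e.toLinearEquiv
  haveI : IsGalois P.F L := IsGalois.of_algEquiv e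
  haveI : NumberField L := NumberField.of_module_finite P.F L
  obtain ⟨𝔓, h𝔓⟩ := HeightOneSpectrum.primesAbove_nonempty v
  haveI : 𝔓.IsPrime := h𝔓.1
  haveI : 𝔓.LiesOver v.asIdeal := h𝔓.2
  set I : Subgroup (absoluteGaloisGroup P.F) := 𝔓.inertia (absoluteGaloisGroup P.F) with hIdef
  -- a multiplicative quadratic twist `E′ = E_λ^{(d)}` at the bad place `v`
  have hord : ord P.F v (jInv P.x) < 0 := (mem_badPlaces_iff_ord_neg P v).1 hbad
  have hj0 : jInv P.x ≠ 0 := fun h0 => by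
    rw [h0, ord_zero] at hord
    exact lt_irrefl _ hord
  have hj : 1 < v.valuation P.F P.legendreCurve.j := by
    rw [j_legendre P hU]
    exact (ord_neg_iff_one_lt_valuation P.F v hj0).1 hord
  obtain ⟨d, hd, hmult⟩ :=
    P.legendreCurve.exists_hasMultiplicativeReductionAt_quadraticTwist_of_one_lt_valuation_j v hj
  haveI : (P.legendreCurve.quadraticTwist d).IsElliptic := P.legendreCurve.isElliptic_quadraticTwist hd
  set E' : WeierstrassCurve P.F := P.legendreCurve.quadraticTwist d with hE'def
  -- (a) the mod-`p` cyclotomic character `χ̄_p` and `Z = ker χ̄_p`: `[I : Z ∩ I] ∣ p − 1`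
  haveI : NeZero p := ⟨hp.ne_zero⟩
  haveI : CharZero Ω := charZero_of_injective_algebraMap (algebraMap P.F Ω).injective
  obtain ⟨μ, hμ⟩ := HasEnoughRootsOfUnity.exists_primitiveRoot Ω p
  set χ : absoluteGaloisGroup P.F →* (ZMod p)ˣ :=
    (hμ.autToPow P.F).comp (absoluteGaloisGroup.toAlgEquiv P.F).toMonoidHom with hχ
  set Z : Subgroup (absoluteGaloisGroup P.F) := χ.ker with hZ
  have hZr : Z.relIndex I ∣ p - 1 := by
    have hc : Nat.card (ZMod p)ˣ = p - 1 := by rw [Nat.card_eq_fintype_card, ZMod.card_units p]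
    rw [hZ, Subgroup.relIndex_ker, ← hc]
    exact Subgroup.card_subgroup_dvd_card (I.map χ)
  have hZfix : ∀ σ ∈ Z, ∀ ζ : Ω, ζ ^ p = 1 → σ • ζ = ζ := by
    intro σ hσ ζ hζ
    have hσμ : σ • μ = μ := by
      have h1 : hμ.autToPow P.F (absoluteGaloisGroup.toAlgEquiv P.F σ) = 1 := (MonoidHom.mem_ker).1 hσ
      have h2 := hμ.autToPow_spec P.F (absoluteGaloisGroup.toAlgEquiv P.F σ)
      rw [h1, Units.val_one, ZMod.val_one, pow_one] at h2
      rw [absoluteGaloisGroup.smul_def]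
      exact h2.symm
    obtain ⟨i, -, rfl⟩ := hμ.eq_pow_of_pow_eq_one hζ
    rw [absoluteGaloisGroup.smul_def] at hσμ ⊢
    rw [map_pow, hσμ]
  -- (b) the SPLIT input: `Z ∩ I ≤ K′ = ker ρ̄_{E′,p}`
  set K' : Subgroup (absoluteGaloisGroup P.F) := (E'.galoisRepTorsion (p : ℤ)).ker with hK'
  have hZK' : Z ⊓ I ≤ K' := fun σ hσ =>
    (MonoidHom.mem_ker).2 (Hp 𝔓 h𝔓 d hd hmult σ hσ.2 (hZfix σ hσ.1))
  -- (c) an element of `K′ ∩ I` fixes every square root of every `a ∈ F_tpd^×`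
  have hsqrt : ∀ σ ∈ K' ⊓ I, ∀ a : P.F, a ≠ 0 → ∀ z : AlgebraicClosure P.F,
      z ^ 2 = algebraMap P.F (AlgebraicClosure P.F) a → σ • z = z := by
    intro σ hσ a ha z hz
    have hζ : ∀ ζ : AlgebraicClosure P.F, ζ ^ p = 1 → σ • ζ = ζ := fun ζ hζ =>
      E'.smul_eq_of_pow_prime_eq_one_of_mem_ker_galoisRepTorsion hp hσ.1 hζ
    obtain ⟨ps, hps0, hps1, hpsfix⟩ : ∃ ps : P.F, ps ≠ 0 ∧ ord P.F v ps = 1 ∧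
        ∀ z₀ : AlgebraicClosure P.F, z₀ ^ 2 = algebraMap P.F (AlgebraicClosure P.F) ps → σ • z₀ = z₀ := by
      rcases hpq with ⟨rfl, -⟩ | ⟨rfl, -⟩
      · refine ⟨-3, by norm_num, ?_, fun z₀ hz₀ => smul_eq_of_sq_eq_neg_three hζ hz₀⟩
        rw [show (-3 : P.F) = -((3 : ℕ) : P.F) by norm_num, ord_neg']
        exact hp1
      · refine ⟨5, by norm_num, ?_, fun z₀ hz₀ => smul_eq_of_sq_eq_five hζ hz₀⟩
        exact_mod_cast hp1
    rcases Int.even_or_odd (ord P.F v a) with ⟨m, hm⟩ | ⟨m, hm⟩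
    · -- even order: inertia fixes `√a`
      have hval : v.valuation P.F a = WithZero.exp (2 * (-m)) := by
        rw [valuation_eq_exp_neg_ord v ha, hm]
        congr 1
        ring
      exact smul_eq_of_mem_inertia_of_sq_eq_of_valuation_eq_exp_even v h𝔓 hσ.2 h2' hval hz
    · -- odd order: `a·p*` has even order
      have hval : v.valuation P.F (a * ps) = WithZero.exp (2 * (-(m + 1))) := by
        rw [valuation_eq_exp_neg_ord v (mul_ne_zero ha hps0), ord_mul P.F v ha hps0, hm, hps1]
        congr 1
        ring
      exact smul_eq_of_sq_eq_of_valuation_mul_eq_exp_even v h𝔓 hσ.2 h2' hps0 hval hpsfix hz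
  have hNd : ∀ σ ∈ K' ⊓ I, σ • geomSqrt d = geomSqrt d := fun σ hσ => hsqrt σ hσ d hd _ (geomSqrt_sq d)
  have hKp : ∀ σ ∈ K' ⊓ I, σ ∈ (P.legendreCurve.galoisRepTorsion (p : ℤ)).ker := fun σ hσ =>
    P.legendreCurve.ker_galoisRepTorsion_quadraticTwist_inf_stabilizer_le (p : ℤ) hd
      (Subgroup.mem_inf.2 ⟨hσ.1, MulAction.mem_stabilizer_iff.2 (hNd σ hσ)⟩)
  -- (e) `Kq = ker ρ̄_{E_λ,q}` has index `∣ k` in `K′ ∩ (Z ∩ I)`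
  set Kq : Subgroup (absoluteGaloisGroup P.F) := (P.legendreCurve.galoisRepTorsion (q : ℤ)).ker with hKq
  have hKqr : Kq.relIndex (K' ⊓ (Z ⊓ I)) ∣ k := by
    rw [hKq, Subgroup.relIndex_ker]
    refine P.legendreCurve.natCard_map_galoisRepTorsion_dvd_of_forall_pow_eq_one_of_dvd hq hk (K' ⊓ (Z ⊓ I))
      fun σ hσ => ?_
    have hσI : σ ∈ K' ⊓ I := ⟨hσ.1, hσ.2.2⟩
    exact H 𝔓 h𝔓 d hd hmult σ hσI.2 (hNd σ hσI)
  -- (f) `[I : Kq ∩ K′ ∩ Z] ∣ k · 1 · (p − 1)`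
  have hchain : (Kq ⊓ K' ⊓ Z).relIndex I ∣ (p - 1) * k := by
    rw [← Subgroup.relIndex_inf_mul_relIndex (Kq ⊓ K') Z I, ← Subgroup.relIndex_inf_mul_relIndex Kq K' (Z ⊓ I),
      Subgroup.relIndex_eq_one.mpr hZK', mul_one]
    calc Kq.relIndex (K' ⊓ (Z ⊓ I)) * Z.relIndex I ∣ k * (p - 1) := mul_dvd_mul hKqr hZr
      _ = (p - 1) * k := by ring
  -- (3) the gens-fixer `Hg ≤ Gal(F̄_tpd/L)` (as in `SubThetaFieldRamificationSixty`)
  set K3 : Subgroup (absoluteGaloisGroup P.F) := (P.legendreCurve.galoisRepTorsion ((3 : ℕ) : ℤ)).ker with hK3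
  set K5 : Subgroup (absoluteGaloisGroup P.F) := (P.legendreCurve.galoisRepTorsion ((5 : ℕ) : ℤ)).ker with hK5
  set Hg : Subgroup (absoluteGaloisGroup P.F) :=
    K3 ⊓ K5 ⊓ (sqrtFixer P (-1) ⊓ (sqrtFixer P P.x ⊓ sqrtFixer P (P.x - 1))) with hHgdef
  have hHN : Hg ≤ L.fixingSubgroup := by
    intro τ hτ
    refine mem_fixingSubgroup_adjoin_of_forall_eq (σ := Field.absoluteGaloisGroup.toAlgEquiv P.F τ) fun s hs => ?_
    obtain ⟨x, hx, rfl⟩ := hs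
    rcases hx with (hsq | hsq | hsq) | htor
    · have : (φ x) ^ 2 = algebraMap P.F Ω (-1) := by rw [← map_pow, hsq, map_neg, map_one, map_neg, map_one]
      exact forall_eq_of_mem_fixingSubgroup_adjoin hτ.2.1 _ this
    · have : (φ x) ^ 2 = algebraMap P.F Ω P.x := by rw [← map_pow, hsq, φ.commutes]
      exact forall_eq_of_mem_fixingSubgroup_adjoin hτ.2.2.1 _ this
    · have : (φ x) ^ 2 = algebraMap P.F Ω (P.x - 1) := by
        rw [← map_pow, hsq, map_sub, map_one, φ.commutes, map_sub, map_one]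
      exact forall_eq_of_mem_fixingSubgroup_adjoin hτ.2.2.2 _ this
    · rw [torsionCoords_eq] at htor
      obtain ⟨T, hT, hxT⟩ := Set.mem_iUnion₂.1 htor
      have hT15 : (15 : ℤ) • T = 0 := hT
      let T' : geomPoints P.legendreCurve := Affine.Point.map (W' := P.legendreCurve.toAffine) φ T
      have hT' : (15 : ℤ) • T' = 0 := by
        change (15 : ℤ) • Affine.Point.map (W' := P.legendreCurve.toAffine) φ T = 0
        rw [← map_zsmul, hT15, map_zero]
      have h3' : ∀ Q : geomTorsion P.legendreCurve ((3 : ℕ) : ℤ), τ • Q = Q := by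
        intro Q
        have hQ := galoisRepTorsion_apply P.legendreCurve ((3 : ℕ) : ℤ) τ Q
        rw [(MonoidHom.mem_ker).1 hτ.1.1] at hQ
        exact hQ.symm
      have h5' : ∀ Q : geomTorsion P.legendreCurve ((5 : ℕ) : ℤ), τ • Q = Q := by
        intro Q
        have hQ := galoisRepTorsion_apply P.legendreCurve ((5 : ℕ) : ℤ) τ Q
        rw [(MonoidHom.mem_ker).1 hτ.1.2] at hQ
        exact hQ.symm
      have hfix : τ • T' = T' := smul_eq_of_fifteen τ h3' h5' T' hT'
      refine forall_coords_of_smul_eq P τ T' hfix (φ x) ?_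
      rcases T with _ | ⟨a, b, hab⟩
      · simp [pointCoords] at hxT
      · change φ x ∈ pointCoords (Affine.Point.map (W' := P.legendreCurve.toAffine) φ
          (Affine.Point.some a b hab))
        rw [Affine.Point.map_some]
        simp only [pointCoords, Set.mem_insert_iff, Set.mem_singleton_iff] at hxT ⊢
        rcases hxT with rfl | rfl
        · exact Or.inl rfl
        · exact Or.inr rfl
  -- `Kq ∩ K′ ∩ Z ∩ I ≤ Hg`, so `[I : Hg ∩ I] ∣ (p−1)k`
  have hHr : Hg.relIndex I ∣ (p - 1) * k := by
    have hle : Kq ⊓ K' ⊓ Z ⊓ I ≤ Hg := by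
      intro τ hτ
      have hτKI : τ ∈ K' ⊓ I := ⟨hτ.1.1.2, hτ.2⟩
      have hτp := hKp τ hτKI
      have hτq : τ ∈ Kq := hτ.1.1.1
      have h35 : τ ∈ K3 ∧ τ ∈ K5 := by
        rcases hpq with ⟨rfl, rfl⟩ | ⟨rfl, rfl⟩
        · exact ⟨hτp, hτq⟩
        · exact ⟨hτq, hτp⟩
      have hsq : ∀ a : P.F, a ≠ 0 → τ ∈ sqrtFixer P a := fun a ha =>
        mem_fixingSubgroup_adjoin_of_forall_eq (σ := Field.absoluteGaloisGroup.toAlgEquiv P.F τ)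
          fun z hz => hsqrt τ hτKI a ha z hz
      exact ⟨⟨h35.1, h35.2⟩, hsq (-1) (by norm_num), hsq P.x hU.1, hsq (P.x - 1) (sub_ne_zero.mpr hU.2)⟩
    have h := Subgroup.relIndex_dvd_of_le_left I hle
    rw [Subgroup.inf_relIndex_right] at h
    exact h.trans hchain
  -- (5) `e(w | v)`, read on the inertia group of `Gal(L/F_tpd)`, divides `[I : I ∩ Gal(F̄/L)] ∣ [I : I ∩ Hg]`
  set Q : Ideal (𝓞 L) := w.asIdeal.map (RingOfIntegers.mapAlgEquiv e : 𝓞 F ≃ₐ[𝓞 P.F] 𝓞 L) with hQ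
  haveI : Q.IsPrime := isPrime_map_mapAlgEquiv e w
  haveI : Q.LiesOver v.asIdeal := liesOver_map_mapAlgEquiv e w _
  rw [← ramificationIdx_map_mapAlgEquiv e w]
  set r : absoluteGaloisGroup P.F →* (L ≃ₐ[P.F] L) := AlgEquiv.restrictNormalHom L with hr
  have hker : r.ker = L.fixingSubgroup := IntermediateField.restrictNormalHom_ker L
  have h1 : (𝔓.comap (ringOfIntegersToIntegralClosure (k := P.F) (Ω := Ω) L)).inertia (L ≃ₐ[P.F] L) ≤
      I.map r := by
    intro g hg
    obtain ⟨σ, hσ, hσg⟩ := @exists_mem_inertia_restrict_eq P.F _ _ L _ _ 𝔓 h𝔓.1 g hg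
    refine ⟨σ, hσ, AlgEquiv.ext fun x => Subtype.ext ?_⟩
    change (algebraMap L Ω) ((σ.restrictNormal L) x) = (algebraMap L Ω) (g x)
    rw [AlgEquiv.restrictNormal_commutes]
    exact hσg x
  have key : Q.ramificationIdx (𝓞 P.F) ∣ (p - 1) * k := by
    rw [@ramificationIdx_eq_card_inertia_comap P.F _ _ L _ _ v 𝔓 h𝔓.1 h𝔓.2 Q _ _]
    have hdvd : Nat.card ((𝔓.comap (ringOfIntegersToIntegralClosure (k := P.F) (Ω := Ω) L)).inertia
        (L ≃ₐ[P.F] L)) ∣ L.fixingSubgroup.relIndex I := by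
      have h := Subgroup.card_dvd_of_le h1
      rwa [← Subgroup.relIndex_ker I r, hker] at h
    exact hdvd.trans ((Subgroup.relIndex_dvd_of_le_left I hHN).trans hHr)
  exact key

/-! ## §2. The SPLIT input from the Tate curve, and the two divisibilities -/

omit [NumberField F] in
/-- **(Hp) from the Tate curve.** If the Tate parameter of `E_λ` at `v` (the `q₀ ∈ F_{tpd,v}` with `q₀ ≠ 0`, `|q₀|_v < 1`,
`j(E_{q₀}) = j(λ)`) is a `p`-th power in `F_{tpd,v}`, then for every quadratic twist `E′ = E_λ^{(d)}` multiplicative at `v`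
(same `j = j(λ)`: `Cor22.j_legendre`, `j_quadraticTwist`) every inertia element `σ ∈ I_𝔓` (`𝔓 ∣ v`) fixing `μ_p` has
`ρ̄_{E′,p}(σ) = 1` (`WeierstrassCurve.galoisRepTorsion_eq_one_of_mem_inertia_of_pow_eq_tateParameter`: `K_v(E′[p]) ⊆
K_v^{nr}(ζ_p, q₀^{1/p})`). [cite: SilvermanATAEC1994, Thm. V.3.1 (c),(d), Thm. V.5.3 (PDF pp. 395–410)] [cite: Serre1972, §1.12] -/
theorem galoisRepTorsion_quadraticTwist_eq_one_of_split (hU : P.InU) [P.legendreCurve.IsElliptic]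
    (w : HeightOneSpectrum (𝓞 F)) {p : ℕ} (hp : p.Prime)
    (hsplit : ∀ q₀ : (finBelow P.F F w).adicCompletion P.F, q₀ ≠ 0 → ‖q₀‖ < 1 →
      tateJ q₀ = algebraMap P.F ((finBelow P.F F w).adicCompletion P.F) (jInv P.x) →
      ∃ y : (finBelow P.F F w).adicCompletion P.F, y ^ p = q₀)
    {𝔓 : Ideal (absIntegers (𝓞 P.F) P.F)} (h𝔓 : 𝔓 ∈ (finBelow P.F F w).primesAbove) {d : P.F} (hd : d ≠ 0)
    (hmult : (P.legendreCurve.quadraticTwist d).HasMultiplicativeReductionAt (finBelow P.F F w))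
    {σ : absoluteGaloisGroup P.F} (hσ : σ ∈ 𝔓.inertia (absoluteGaloisGroup P.F))
    (hζ : ∀ ζ : AlgebraicClosure P.F, ζ ^ p = 1 → σ • ζ = ζ) :
    (P.legendreCurve.quadraticTwist d).galoisRepTorsion ((p : ℕ) : ℤ) σ = 1 := by
  set v := finBelow P.F F w with hvdef
  haveI : (P.legendreCurve.quadraticTwist d).IsElliptic := P.legendreCurve.isElliptic_quadraticTwist hd
  letI := Literature.NumberTheory.GaloisRepresentations.Ultrametric.AdicCompletion.nontriviallyNormedField P.F v
  haveI := TateCurve.charZero_adicCompletion' P.F v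
  have hj := TateCurve.one_lt_norm_j_baseChange_of_hasMultiplicativeReductionAt
    (P.legendreCurve.quadraticTwist d) v hmult
  obtain ⟨q₀, ⟨hq0, hq1, hqj⟩, -⟩ := existsUnique_tateJ_eq_of_one_lt_norm hj
  have hjE : ((P.legendreCurve.quadraticTwist d).baseChange (v.adicCompletion P.F)).j =
      algebraMap P.F (v.adicCompletion P.F) (jInv P.x) := by
    have h1 : (P.legendreCurve.quadraticTwist d).j = jInv P.x := by
      rw [P.legendreCurve.j_quadraticTwist hd, j_legendre P hU]
    rw [← h1]
    exact (P.legendreCurve.quadraticTwist d).map_j _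
  obtain ⟨y, hy⟩ := hsplit q₀ hq0 hq1 (hqj.trans hjE)
  exact (P.legendreCurve.quadraticTwist d).galoisRepTorsion_eq_one_of_mem_inertia_of_pow_eq_tateParameter
    hmult hp.pos hq0 hq1 hqj hy h𝔓 hσ hζ

/-- **SPLIT ⇒ `e(w | v) ∣ (p − 1)·p′`** for every place `w` of a field pinned by `IsSubThetaField P F` (Galois over `F_tpd`)
over a BAD place `v ∣ p ∈ {3, 5}` of `λ` unramified over `p` (`{p, p′} = {3, 5}`), when the Tate parameter of `E_λ` at `v` is a
`p`-th power in `F_{tpd,v}`: (Hp) from `galoisRepTorsion_quadraticTwist_eq_one_of_split`, (H) with `k = p′` from unipotence of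
tame inertia (abc-iut-L5-t12). Numerically `e ∣ 10` at `v ∣ 3`, `e ∣ 20` at `v ∣ 5` — the UPPER half of the SPLIT wild local type
`e(F_w/ℚ_p) = (p−1)·r` (GAP G-Wnum2-1 (i), split packets). [cite: Serre1972, §1.11–§1.12]
[cite: SilvermanATAEC1994, Thm. V.3.1 (c),(d), Thm. V.5.3] [cite: Mochizuki2012, IUTchIV Thm 1.10 proof Step (iii) (R2)–(R4) p.25–26] -/
theorem ramificationIdx_subThetaField_dvd_split (hU : P.InU) (hF : IsSubThetaField P F) [IsGalois P.F F]
    (w : HeightOneSpectrum (𝓞 F)) (hbad : finBelow P.F F w ∈ badPlaces P)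
    {p q : ℕ} (hpq : (p = 3 ∧ q = 5) ∨ (p = 5 ∧ q = 3))
    (hpv : ((p : ℕ) : 𝓞 P.F) ∈ (finBelow P.F F w).asIdeal)
    (hp1 : ord P.F (finBelow P.F F w) (p : P.F) = 1)
    (hsplit : ∀ q₀ : (finBelow P.F F w).adicCompletion P.F, q₀ ≠ 0 → ‖q₀‖ < 1 →
      tateJ q₀ = algebraMap P.F ((finBelow P.F F w).adicCompletion P.F) (jInv P.x) →
      ∃ y : (finBelow P.F F w).adicCompletion P.F, y ^ p = q₀) :
    w.asIdeal.ramificationIdx (𝓞 P.F) ∣ (p - 1) * q := by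
  haveI : P.legendreCurve.IsElliptic := P.legendreCurve_isElliptic_iff.2 hU
  have hp : p.Prime := by rcases hpq with ⟨rfl, -⟩ | ⟨rfl, -⟩ <;> norm_num
  have hq : q.Prime := by rcases hpq with ⟨-, rfl⟩ | ⟨-, rfl⟩ <;> norm_num
  have hqv : ((q : ℕ) : 𝓞 P.F) ∉ (finBelow P.F F w).asIdeal :=
    natCast_not_mem_of_coprime _ (by rcases hpq with ⟨rfl, rfl⟩ | ⟨rfl, rfl⟩ <;> norm_num) hpv
  refine ramificationIdx_subThetaField_dvd_split_of_forall_inertia F hU hF w hbad hpq hpv hp1 (dvd_refl q)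
    (fun 𝔓 h𝔓 d hd hmult σ hσ hζ => ?_)
    fun 𝔓 h𝔓 d hd hmult σ hσ hσd =>
      P.legendreCurve.galoisRepTorsion_pow_eq_one_of_mem_inertia_of_hasMultiplicativeReductionAt_quadraticTwist
        hq hd hmult hqv h𝔓 hσ hσd
  exact galoisRepTorsion_quadraticTwist_eq_one_of_split F hU w hp hsplit h𝔓 hd hmult hσ hζ

/-- **SPLIT and `p′ ∣ ord_v j(λ)` ⇒ `e(w | v) ∣ p − 1`** (`v ∣ p ∈ {3, 5}` a bad place of `λ` unramified over `p`, `{p, p′} =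
{3, 5}`, the Tate parameter at `v` a `p`-th power in `F_{tpd,v}`): `ρ̄_{E_λ,p′}` is TRIVIAL along inertia on `Γ_{F_tpd(√d)}` by the
Tate criterion (`galoisRepTorsion_eq_one_of_mem_inertia_of_dvd_ord`), so `k = 1`; numerically `e ∣ 2` at `v ∣ 3`, `e ∣ 4` at
`v ∣ 5` (`r = 1`). [cite: Serre1972, §1.11–§1.12] [cite: SilvermanATAEC1994, Thm. V.3.1 (c),(d), Thm. V.5.3]
[cite: Mochizuki2012, IUTchIV Thm 1.10 proof Step (iii) (R2)–(R4) p.25–26] -/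
theorem ramificationIdx_subThetaField_dvd_split_of_dvd_ord (hU : P.InU) (hF : IsSubThetaField P F)
    [IsGalois P.F F] (w : HeightOneSpectrum (𝓞 F)) (hbad : finBelow P.F F w ∈ badPlaces P)
    {p q : ℕ} (hpq : (p = 3 ∧ q = 5) ∨ (p = 5 ∧ q = 3))
    (hpv : ((p : ℕ) : 𝓞 P.F) ∈ (finBelow P.F F w).asIdeal)
    (hp1 : ord P.F (finBelow P.F F w) (p : P.F) = 1)
    (hqord : (q : ℤ) ∣ ord P.F (finBelow P.F F w) (jInv P.x))
    (hsplit : ∀ q₀ : (finBelow P.F F w).adicCompletion P.F, q₀ ≠ 0 → ‖q₀‖ < 1 →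
      tateJ q₀ = algebraMap P.F ((finBelow P.F F w).adicCompletion P.F) (jInv P.x) →
      ∃ y : (finBelow P.F F w).adicCompletion P.F, y ^ p = q₀) :
    w.asIdeal.ramificationIdx (𝓞 P.F) ∣ p - 1 := by
  haveI : P.legendreCurve.IsElliptic := P.legendreCurve_isElliptic_iff.2 hU
  have hp : p.Prime := by rcases hpq with ⟨rfl, -⟩ | ⟨rfl, -⟩ <;> norm_num
  have hq : q.Prime := by rcases hpq with ⟨-, rfl⟩ | ⟨-, rfl⟩ <;> norm_num
  have hqv : ((q : ℕ) : 𝓞 P.F) ∉ (finBelow P.F F w).asIdeal :=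
    natCast_not_mem_of_coprime _ (by rcases hpq with ⟨rfl, rfl⟩ | ⟨rfl, rfl⟩ <;> norm_num) hpv
  have h := ramificationIdx_subThetaField_dvd_split_of_forall_inertia F hU hF w hbad hpq hpv hp1 (one_dvd q)
    (fun 𝔓 h𝔓 d hd hmult σ hσ hζ => galoisRepTorsion_quadraticTwist_eq_one_of_split F hU w hp hsplit h𝔓 hd hmult hσ hζ)
    fun 𝔓 h𝔓 d hd hmult σ hσ hσd => by
      rw [pow_one]
      exact galoisRepTorsion_eq_one_of_mem_inertia_of_dvd_ord hU hq hqv hqord hd hmult h𝔓 hσ hσd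
  simpa using h

end Cor22

end Literature.IUT.LogVolume

end
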